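import Literature.Probability.LatticeModels.SpinWaveComplexStabilityTorus
import Summits.HubbardSuperconductivity.HubbardSuperconductivity.Theorems.NodalWardXYDefs
import Summits.HubbardSuperconductivity.HubbardSuperconductivity.Theorems.NodalWardXYPerturbedXYOrderEntire
import Summits.HubbardSuperconductivity.HubbardSuperconductivity.Theorems.NodalWardXYPerturbedXYOrderSmallVolume
import Summits.HubbardSuperconductivity.HubbardSuperconductivity.Theorems.NodalWardXYPerturbedXYOrderFixedVolume

/-!
# `PerturbedXYOrder` (stmt-HubbardSuperconductivity-10739) — line `schwarz-inheritance`, stub `stub_explicitVolumeThreshold`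

Explicit coupling threshold for complex stability at fixed volume: for `0 < ε ≤ 1/576` and
`J ≥ 1152 ε L³ (4 + log L)`, every kernel `K` admissible at radius `ε` on `(ℤ/Lℤ)³` has `Z_K ≠ 0` and
`‖num_K / Z_K / L⁶‖ ≤ 40` (the `∃ J₀(ε, L)` of `stub_fixedVolumeStability` made explicit).  With
`H = Σ_b (1 - cos ∇_b θ)` and `w_J = e^{3L³J} e^{-JH}`: the relative form bound `‖W_K‖ ≤ 288 ε H` is
uniform in `L` (row AND column sums `≤ 144 ε`, `sin² ≤ 2(1 - cos)`); on the GOOD region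
`{H ≤ 1/(288ε)}`, `‖W_K‖ ≤ 1` gives `Re (w_J e^{W_K}) ≥ w_J/6` and `‖w_J e^{W_K}‖ ≤ 3 w_J`; the BAD
region weighs `≤ (2π)^{L³} e^{3L³J} e^{-(J-288ε)/(288ε)}`, at most `1/12` (`evt_key_numeric`) of the good
mass `≥ e^{3L³J} e^{-J} (2/(3L²))^{L³}` carried by the box `|θ_x - π| ≤ 1/(3L²) ⊆ {H ≤ 1}`; hence
`Re Z_K ≥ I/12 > 0`, `∫ ‖w_J e^{W_K}‖ ≤ (37/12) I` and `‖cratio‖ ≤ 37 ≤ 40`.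
-/

noncomputable section

namespace Summit.HubbardSuperconductivity.HubbardSuperconductivity.Theorems.PerturbedXYOrder

open MeasureTheory Literature.Probability.LatticeModels
open Summit.HubbardSuperconductivity.HubbardSuperconductivity.Theses.NodalWardXY

variable {L : ℕ}

/-- **Relative form bound, uniform in `L`**: for `K` admissible at radius `ε ≥ 0`,
`‖W_K(θ)‖ ≤ 288 ε · Σ_b (1 - cos ∇_b θ)` (row and column sums `≤ 144 ε`,
`|j_b j_{b'}| ≤ (j_b² + j_{b'}²)/2`, `j² = sin² ≤ 2 (1 - cos)`). -/
theorem evt_norm_Wk_le_energy [NeZero L] {ε : ℝ} (hε : 0 ≤ ε) {K : Bond L → Bond L → ℂ}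
    (hK : Admissible L ε K) (θ : TorusSite 3 L → ℝ) :
    ‖Wk K θ‖ ≤ 288 * ε * ∑ b : Bond L, (1 - Real.cos (θ (b.1 + Pi.single b.2 1) - θ b.1)) := by
  have hrow : ∀ b : Bond L, ∑ b', ‖K b b'‖ ≤ 144 * ε := row_sum_norm_le_of_admissible K hK
  have hcol : ∀ b' : Bond L, ∑ b, ‖K b b'‖ ≤ 144 * ε := col_sum_norm_le_of_admissible K hK
  set s : Bond L → ℝ := fun b => cur b θ with hs
  have hterm : ∀ b b', ‖K b b' * (cur b θ : ℂ) * (cur b' θ : ℂ)‖ ≤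
      (s b) ^ 2 / 2 * ‖K b b'‖ + (s b') ^ 2 / 2 * ‖K b b'‖ := by
    intro b b'
    rw [norm_mul, norm_mul, Complex.norm_real, Complex.norm_real, Real.norm_eq_abs, Real.norm_eq_abs]
    have h2 : |cur b θ| * |cur b' θ| ≤ ((s b) ^ 2 + (s b') ^ 2) / 2 := by
      have := two_mul_le_add_sq (|cur b θ|) (|cur b' θ|)
      simp only [sq_abs, hs] at this ⊢
      linarith
    calc ‖K b b'‖ * |cur b θ| * |cur b' θ| = ‖K b b'‖ * (|cur b θ| * |cur b' θ|) := by ring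
      _ ≤ ‖K b b'‖ * (((s b) ^ 2 + (s b') ^ 2) / 2) := mul_le_mul_of_nonneg_left h2 (norm_nonneg _)
      _ = (s b) ^ 2 / 2 * ‖K b b'‖ + (s b') ^ 2 / 2 * ‖K b b'‖ := by ring
  unfold Wk
  calc ‖∑ b : Bond L, ∑ b' : Bond L, K b b' * (cur b θ : ℂ) * (cur b' θ : ℂ)‖
      ≤ ∑ b : Bond L, ∑ b' : Bond L, ‖K b b' * (cur b θ : ℂ) * (cur b' θ : ℂ)‖ :=
        (norm_sum_le _ _).trans (Finset.sum_le_sum fun b _ => norm_sum_le _ _)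
    _ ≤ ∑ b : Bond L, ∑ b' : Bond L, ((s b) ^ 2 / 2 * ‖K b b'‖ + (s b') ^ 2 / 2 * ‖K b b'‖) := by
        gcongr with b _ b' _; exact hterm b b'
    _ = ∑ b : Bond L, (s b) ^ 2 / 2 * ∑ b' : Bond L, ‖K b b'‖ +
          ∑ b' : Bond L, (s b') ^ 2 / 2 * ∑ b : Bond L, ‖K b b'‖ := by
        simp only [Finset.sum_add_distrib, Finset.mul_sum]
        congr 1
        exact Finset.sum_comm
    _ ≤ ∑ b : Bond L, (s b) ^ 2 / 2 * (144 * ε) + ∑ b' : Bond L, (s b') ^ 2 / 2 * (144 * ε) := by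
        gcongr with b _ b' _
        · exact hrow b
        · exact hcol b'
    _ = 144 * ε * ∑ b : Bond L, (s b) ^ 2 := by rw [← Finset.sum_mul, ← Finset.sum_div]; ring
    _ ≤ 144 * ε * ∑ b : Bond L, 2 * (1 - Real.cos (θ (b.1 + Pi.single b.2 1) - θ b.1)) := by
        gcongr with b _; exact fv_sin_sq_le _
    _ = 288 * ε * ∑ b : Bond L, (1 - Real.cos (θ (b.1 + Pi.single b.2 1) - θ b.1)) := by
        rw [← Finset.mul_sum]; ring

/-- `1/3 ≤ e^{-1}` (`e < 3`). -/
theorem evt_third_le_exp_neg_one : (1:ℝ) / 3 ≤ Real.exp (-1) := by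
  rw [Real.exp_neg, one_div]
  exact inv_anti₀ (Real.exp_pos 1) Real.exp_one_lt_three.le

/-- Sector estimate, real part: for `0 ≤ r` and `‖W‖ ≤ 1`, `r / 6 ≤ Re (r e^{W})`
(`Re W ≥ -1`, `|Im W| ≤ 1`, `e^{-1} ≥ 1/3`, `cos (Im W) ≥ 1/2`). -/
theorem evt_re_ge_of_norm_le_one {r : ℝ} (hr : 0 ≤ r) {W : ℂ} (hW : ‖W‖ ≤ 1) :
    r / 6 ≤ ((r : ℂ) * Complex.exp W).re := by
  rw [Complex.re_ofReal_mul, Complex.exp_re]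
  have hcos : (1:ℝ) / 2 ≤ Real.cos W.im := sv_half_le_cos ((Complex.abs_im_le_norm W).trans hW)
  have hre : -1 ≤ W.re := by
    have := (abs_le.1 ((Complex.abs_re_le_norm W).trans hW)).1
    linarith
  have hexp : (1:ℝ) / 3 ≤ Real.exp W.re := evt_third_le_exp_neg_one.trans (Real.exp_le_exp.2 hre)
  have h1 : (1:ℝ) / 6 ≤ Real.exp W.re * Real.cos W.im := by
    calc (1:ℝ) / 6 = 1 / 3 * (1 / 2) := by norm_num
      _ ≤ Real.exp W.re * Real.cos W.im := mul_le_mul hexp hcos (by norm_num) (Real.exp_pos _).le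
  calc r / 6 = r * (1 / 6) := by ring
    _ ≤ r * (Real.exp W.re * Real.cos W.im) := mul_le_mul_of_nonneg_left h1 hr

/-- Sector estimate, modulus: for `0 ≤ r` and `‖W‖ ≤ 1`, `‖r e^{W}‖ ≤ 3 r`. -/
theorem evt_norm_le_of_norm_le_one {r : ℝ} (hr : 0 ≤ r) {W : ℂ} (hW : ‖W‖ ≤ 1) :
    ‖(r : ℂ) * Complex.exp W‖ ≤ 3 * r := by
  rw [norm_mul, Complex.norm_real, Real.norm_eq_abs, abs_of_nonneg hr, Complex.norm_exp]
  have hre : W.re ≤ 1 := (Complex.re_le_norm W).trans hW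
  have h3 : Real.exp W.re ≤ 3 := (Real.exp_le_exp.2 hre).trans Real.exp_one_lt_three.le
  calc r * Real.exp W.re ≤ r * 3 := mul_le_mul_of_nonneg_left h3 hr
    _ = 3 * r := by ring

/-- `‖r e^{W}‖ ≤ r e^{‖W‖}` for `0 ≤ r` (no assumption on `W`). -/
theorem evt_norm_le_mul_exp_norm {r : ℝ} (hr : 0 ≤ r) (W : ℂ) :
    ‖(r : ℂ) * Complex.exp W‖ ≤ r * Real.exp ‖W‖ := by
  rw [norm_mul, Complex.norm_real, Real.norm_eq_abs, abs_of_nonneg hr, Complex.norm_exp]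
  exact mul_le_mul_of_nonneg_left (Real.exp_le_exp.2 (Complex.re_le_norm W)) hr

/-- Configurations within `1/(3L²)` of the constant field `θ ≡ π` (sup norm) have energy `H ≤ 1`:
each bond costs `1 - cos ∇_b θ ≤ (∇_b θ)²/2 ≤ 2/(9L⁴)`, and `3L³ · 2/(9L⁴) = 2/(3L) ≤ 1`. -/
theorem evt_energy_le_one_of_mem_box [NeZero L] {θ : TorusSite 3 L → ℝ}
    (hθ : θ ∈ Set.pi Set.univ fun _ : TorusSite 3 L =>
      Set.Icc (Real.pi - 1 / (3 * (L : ℝ) ^ 2)) (Real.pi + 1 / (3 * (L : ℝ) ^ 2))) :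
    ∑ b : Bond L, (1 - Real.cos (θ (b.1 + Pi.single b.2 1) - θ b.1)) ≤ 1 := by
  set η : ℝ := 1 / (3 * (L : ℝ) ^ 2) with hη
  have hL : (1:ℝ) ≤ (L : ℝ) := Nat.one_le_cast.2 NeZero.one_le
  have hL0 : (L : ℝ) ≠ 0 := Nat.cast_ne_zero.2 (NeZero.ne L)
  have hθx : ∀ x, Real.pi - η ≤ θ x ∧ θ x ≤ Real.pi + η := fun x => Set.mem_univ_pi.1 hθ x
  have hterm : ∀ b : Bond L, 1 - Real.cos (θ (b.1 + Pi.single b.2 1) - θ b.1) ≤ 2 * η ^ 2 := by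
    intro b
    have h1 := Real.one_sub_sq_div_two_le_cos (x := θ (b.1 + Pi.single b.2 1) - θ b.1)
    have hy := hθx (b.1 + Pi.single b.2 1)
    have hx := hθx b.1
    have h3 : (θ (b.1 + Pi.single b.2 1) - θ b.1) ^ 2 ≤ (2 * η) ^ 2 :=
      sq_le_sq' (by linarith [hy.1, hx.2]) (by linarith [hy.2, hx.1])
    linarith
  calc ∑ b : Bond L, (1 - Real.cos (θ (b.1 + Pi.single b.2 1) - θ b.1))
      ≤ ∑ _b : Bond L, 2 * η ^ 2 := Finset.sum_le_sum fun b _ => hterm b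
    _ = 3 * (L : ℝ) ^ 3 * (2 * η ^ 2) := by
        simp only [Finset.sum_const, Finset.card_univ, nsmul_eq_mul, Fintype.card_prod, Fintype.card_fun,
          Fintype.card_fin, ZMod.card]
        push_cast; ring
    _ = 2 / (3 * (L : ℝ)) := by rw [hη]; field_simp
    _ ≤ 1 := by rw [div_le_one (by positivity)]; linarith

/-- The Lebesgue volume of a coordinate box `[a, b]^Λ` over the torus `Λ = (ℤ/Lℤ)³` is `(b - a)^{L³}`. -/
theorem evt_volume_box_toReal [NeZero L] {a b : ℝ} (hab : a ≤ b) :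
    (volume (Set.pi Set.univ fun _ : TorusSite 3 L => Set.Icc a b)).toReal = (b - a) ^ (L ^ 3) := by
  rw [volume_pi_pi]
  simp only [Real.volume_Icc, Finset.prod_const, Finset.card_univ, Fintype.card_fun, Fintype.card_fin,
    ZMod.card, ENNReal.toReal_pow, ENNReal.toReal_ofReal (sub_nonneg.2 hab)]

/-- `19 ≤ e³` (`e > 2.71828`). -/
theorem evt_nineteen_le_exp_three : (19:ℝ) ≤ Real.exp 3 := by
  have h := Real.exp_one_gt_d9
  have h3 : Real.exp 3 = Real.exp 1 * Real.exp 1 * Real.exp 1 := by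
    rw [← Real.exp_add, ← Real.exp_add]; norm_num
  rw [h3]
  nlinarith [Real.exp_pos 1, mul_pos (Real.exp_pos 1) (Real.exp_pos 1)]

/-- **Key numeric inequality.** For `0 < ε ≤ 1/576` and `J ≥ 1152 ε L³ (4 + log L)`:
`(2π)^{L³} e^{-(J - 288ε)/(288ε)} ≤ (1/12) e^{-J} (2/(3L²))^{L³}`, i.e. the sup of `‖w_J e^{W_K}‖` on the
bad region times the volume of the cube is at most `1/12` of the inf of `w_J` on the box times the volume
of the box (after cancelling `e^{3L³J}`).  Proof: `12 ≤ e³`, `3π ≤ e³`, `L² = e^{2 log L}`, and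
`4 + J + L³ (3 + 2 log L) ≤ J/(288ε)` from the threshold and `576 ε ≤ 1`. -/
theorem evt_key_numeric [NeZero L] {ε J : ℝ} (hε : 0 < ε) (hε1 : 576 * ε ≤ 1)
    (hJ : 1152 * ε * (L : ℝ) ^ 3 * (4 + Real.log (L : ℝ)) ≤ J) :
    (2 * Real.pi) ^ (L ^ 3) * Real.exp (-(J - 288 * ε) * (1 / (288 * ε))) ≤
      1 / 12 * (Real.exp (-J) * (2 * (1 / (3 * (L : ℝ) ^ 2))) ^ (L ^ 3)) := by
  set x : ℝ := (L : ℝ) with hx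
  set N : ℕ := L ^ 3 with hN
  have hx1 : (1:ℝ) ≤ x := Nat.one_le_cast.2 NeZero.one_le
  have hx0 : (0:ℝ) < x := by linarith
  have hNx : (N : ℝ) = x ^ 3 := by rw [hN, hx]; push_cast; ring
  have hlog : 0 ≤ Real.log x := Real.log_nonneg hx1
  have hx3 : (1:ℝ) ≤ x ^ 3 := one_le_pow₀ hx1
  have hJ0 : 0 ≤ J := le_trans (by positivity) hJ
  set t : ℝ := J / (288 * ε) with ht
  -- the threshold in additive form
  have hthr : 4 + J + x ^ 3 * (3 + 2 * Real.log x) ≤ t := by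
    rw [ht, le_div_iff₀ (by positivity)]
    nlinarith [mul_nonneg hJ0 (sub_nonneg.2 hε1), mul_nonneg hε.le (sub_nonneg.2 hx3),
      mul_nonneg (mul_nonneg hε.le (zero_le_one.trans hx3)) hlog]
  -- crude transcendental constants: `12 ≤ e³`, `3π ≤ e³`
  have h12 : (12:ℝ) ≤ Real.exp 3 := by linarith [evt_nineteen_le_exp_three]
  have h3pi : 3 * Real.pi ≤ Real.exp 3 := by linarith [Real.pi_lt_four, evt_nineteen_le_exp_three]
  have hx2 : x ^ 2 = Real.exp (2 * Real.log x) := by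
    rw [show (2:ℝ) * Real.log x = Real.log x + Real.log x by ring, Real.exp_add, Real.exp_log hx0]; ring
  have hbase : 3 * Real.pi * x ^ 2 ≤ Real.exp (3 + 2 * Real.log x) := by
    rw [Real.exp_add, hx2]
    exact mul_le_mul_of_nonneg_right h3pi (Real.exp_pos _).le
  have hpow : (3 * Real.pi * x ^ 2) ^ N ≤ Real.exp ((N : ℝ) * (3 + 2 * Real.log x)) := by
    rw [Real.exp_nat_mul]
    exact pow_le_pow_left₀ (by positivity) hbase N
  -- the main comparison `12 (3π x²)^N e^{1+J} ≤ e^t`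
  have key : 12 * (3 * Real.pi * x ^ 2) ^ N * Real.exp (1 + J) ≤ Real.exp t := by
    calc 12 * (3 * Real.pi * x ^ 2) ^ N * Real.exp (1 + J)
        ≤ Real.exp 3 * Real.exp ((N : ℝ) * (3 + 2 * Real.log x)) * Real.exp (1 + J) := by gcongr
      _ = Real.exp (3 + (N : ℝ) * (3 + 2 * Real.log x) + (1 + J)) := by rw [← Real.exp_add, ← Real.exp_add]
      _ ≤ Real.exp t := Real.exp_le_exp.2 (by rw [hNx]; linarith)
  -- algebraic repackaging
  have e1 : (2 * Real.pi) ^ N = (3 * Real.pi * x ^ 2) ^ N * (2 * (1 / (3 * x ^ 2))) ^ N := by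
    rw [← mul_pow]; congr 1; field_simp
  have e2 : Real.exp (-(J - 288 * ε) * (1 / (288 * ε))) = Real.exp (1 + J) * Real.exp (-J) * (Real.exp t)⁻¹ := by
    rw [← Real.exp_neg, ← Real.exp_add, ← Real.exp_add]
    congr 1
    rw [ht]; field_simp; ring
  have key' : (3 * Real.pi * x ^ 2) ^ N * Real.exp (1 + J) ≤ Real.exp t / 12 := by
    rw [le_div_iff₀ (by norm_num)]; linarith
  calc (2 * Real.pi) ^ N * Real.exp (-(J - 288 * ε) * (1 / (288 * ε)))
      = ((3 * Real.pi * x ^ 2) ^ N * Real.exp (1 + J)) *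
          ((2 * (1 / (3 * x ^ 2))) ^ N * Real.exp (-J)) * (Real.exp t)⁻¹ := by rw [e1, e2]; ring
    _ ≤ (Real.exp t / 12) * ((2 * (1 / (3 * x ^ 2))) ^ N * Real.exp (-J)) * (Real.exp t)⁻¹ := by
        gcongr
    _ = 1 / 12 * (Real.exp (-J) * (2 * (1 / (3 * x ^ 2))) ^ N) := by
        field_simp

/-- **Core estimate.** For `0 < ε ≤ 1/576`, `J ≥ 1152 ε L³ (4 + log L)` and `K` admissible at radius `ε`
there is `I > 0` (namely `I = ∫_{cube ∩ {H ≤ 1/(288ε)}} w_J`) with `I / 12 ≤ Re Z_K` and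
`∫_cube ‖w_J e^{W_K}‖ ≤ (37/12) I`. -/
theorem evt_core [NeZero L] {ε J : ℝ} (hε : 0 < ε) (hε1 : 576 * ε ≤ 1)
    (hJ : 1152 * ε * (L : ℝ) ^ 3 * (4 + Real.log (L : ℝ)) ≤ J) {K : Bond L → Bond L → ℂ}
    (hK : Admissible L ε K) :
    ∃ I : ℝ, 0 < I ∧ I / 12 ≤ (Zk J K).re ∧
      ∫ θ in cube L, ‖wJ J θ * Complex.exp (Wk K θ)‖ ≤ 37 / 12 * I := by
  -- elementary numerics
  have hL1 : (1:ℝ) ≤ (L : ℝ) := Nat.one_le_cast.2 NeZero.one_le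
  have hlog : 0 ≤ Real.log (L : ℝ) := Real.log_nonneg hL1
  have hL3 : (1:ℝ) ≤ (L : ℝ) ^ 3 := one_le_pow₀ hL1
  have hJ0 : 0 ≤ J := le_trans (by positivity) hJ
  have hJ288 : 288 * ε ≤ J := by
    have h4 : (4:ℝ) ≤ (L : ℝ) ^ 3 * (4 + Real.log (L : ℝ)) := by
      nlinarith [mul_nonneg (zero_le_one.trans hL3) hlog]
    have := mul_le_mul_of_nonneg_left h4 (by positivity : (0:ℝ) ≤ 1152 * ε)
    nlinarith
  -- the key numeric inequality (before introducing abbreviations, so that `set` folds it)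
  have key := evt_key_numeric (L := L) hε hε1 hJ
  -- notation
  set H : (TorusSite 3 L → ℝ) → ℝ := fun θ =>
    ∑ b : Bond L, (1 - Real.cos (θ (b.1 + Pi.single b.2 1) - θ b.1)) with hHdef
  set w : (TorusSite 3 L → ℝ) → ℝ := fun θ =>
    Real.exp (J * ∑ b : Bond L, Real.cos (θ (b.1 + Pi.single b.2 1) - θ b.1)) with hwdef
  set f : (TorusSite 3 L → ℝ) → ℂ := fun θ => wJ J θ * Complex.exp (Wk K θ) with hfdef
  set A : ℝ := Real.exp (3 * (L : ℝ) ^ 3 * J) with hAdef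
  set h : ℝ := 1 / (288 * ε) with hhdef
  set η : ℝ := 1 / (3 * (L : ℝ) ^ 2) with hηdef
  set G : Set (TorusSite 3 L → ℝ) := {θ | H θ ≤ h} with hGdef
  set Box : Set (TorusSite 3 L → ℝ) :=
    Set.pi Set.univ fun _ : TorusSite 3 L => Set.Icc (Real.pi - η) (Real.pi + η) with hBoxdef
  set C : ℝ := A * Real.exp (-(J - 288 * ε) * h) with hCdef
  set m : ℝ := A * Real.exp (-J) with hmdef
  set I : ℝ := ∫ θ in cube L ∩ G, w θ with hIdef
  -- elementary facts on `h`, `η`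
  have hh1 : 1 ≤ h := by rw [hhdef, le_div_iff₀ (by positivity)]; linarith
  have hεh : 288 * ε * h = 1 := by rw [hhdef]; field_simp
  have hη0 : 0 < η := by positivity
  have hηle : η ≤ 1 / 3 := one_div_le_one_div_of_le (by norm_num) (by nlinarith)
  have hηpi : η < Real.pi := by linarith [Real.pi_gt_three]
  -- pointwise facts
  have hw_eq : ∀ θ, w θ = A * Real.exp (-J * H θ) := fun θ => fv_weight_eq J θ
  have hw0 : ∀ θ, 0 ≤ w θ := fun θ => (Real.exp_pos _).le
  have hH0 : ∀ θ, 0 ≤ H θ := fun θ => fv_energy_nonneg θ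
  have hWH : ∀ θ, ‖Wk K θ‖ ≤ 288 * ε * H θ := fun θ => evt_norm_Wk_le_energy hε.le hK θ
  have hgoodW : ∀ θ, H θ ≤ h → ‖Wk K θ‖ ≤ 1 := fun θ hθ => by
    calc ‖Wk K θ‖ ≤ 288 * ε * H θ := hWH θ
      _ ≤ 288 * ε * h := mul_le_mul_of_nonneg_left hθ (by positivity)
      _ = 1 := hεh
  have hgood_re : ∀ θ, H θ ≤ h → w θ / 6 ≤ (f θ).re := fun θ hθ =>
    evt_re_ge_of_norm_le_one (hw0 θ) (hgoodW θ hθ)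
  have hgood_norm : ∀ θ, H θ ≤ h → ‖f θ‖ ≤ 3 * w θ := fun θ hθ =>
    evt_norm_le_of_norm_le_one (hw0 θ) (hgoodW θ hθ)
  have hbad : ∀ θ, h < H θ → ‖f θ‖ ≤ C := fun θ hθ => by
    calc ‖f θ‖ ≤ w θ * Real.exp ‖Wk K θ‖ := evt_norm_le_mul_exp_norm (hw0 θ) _
      _ ≤ w θ * Real.exp (288 * ε * H θ) := by gcongr; exact hWH θ
      _ = A * Real.exp (-(J - 288 * ε) * H θ) := by
          rw [hw_eq θ, mul_assoc, ← Real.exp_add]; congr 1; congr 1; ring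
      _ ≤ A * Real.exp (-(J - 288 * ε) * h) :=
          mul_le_mul_of_nonneg_left (Real.exp_le_exp.2 (mul_le_mul_of_nonpos_left hθ.le (by linarith)))
            (Real.exp_pos _).le
  have hBox_H : ∀ θ ∈ Box, H θ ≤ 1 := fun θ hθ => evt_energy_le_one_of_mem_box hθ
  have hBox_cube : Box ⊆ cube L :=
    Set.pi_mono fun x _ => Set.Icc_subset_Icc (by linarith) (by linarith [Real.pi_pos])
  have hBox_G : Box ⊆ cube L ∩ G := fun θ hθ => ⟨hBox_cube hθ, (hBox_H θ hθ).trans hh1⟩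
  have hBox_w : ∀ θ ∈ Box, m ≤ w θ := fun θ hθ => by
    rw [hw_eq θ]
    refine mul_le_mul_of_nonneg_left (Real.exp_le_exp.2 ?_) (Real.exp_pos _).le
    nlinarith [hBox_H θ hθ, hH0 θ]
  -- measurability, integrability, volumes
  have hcube_meas : MeasurableSet (cube L) := ent_isCompact_cube.measurableSet
  have hG_meas : MeasurableSet G := measurableSet_le fv_continuous_energy.measurable measurable_const
  have hBox_meas : MeasurableSet Box := MeasurableSet.univ_pi fun _ => measurableSet_Icc
  have hcube_fin : volume (cube L) < ⊤ := ent_isCompact_cube.measure_lt_top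
  have hfi : IntegrableOn f (cube L) volume := sv_integrable_integrand J K
  have hwi : IntegrableOn w (cube L) volume :=
    (continuous_xyWeight J).continuousOn.integrableOn_compact ent_isCompact_cube
  have hrei : IntegrableOn (fun θ => (f θ).re) (cube L) volume :=
    (Complex.continuous_re.comp (sv_continuous_integrand J K)).continuousOn.integrableOn_compact
      ent_isCompact_cube
  have hVc : volume.real (cube L) = (2 * Real.pi) ^ (L ^ 3) := by
    rw [measureReal_def]
    unfold cube
    rw [evt_volume_box_toReal (a := 0) (b := 2 * Real.pi) (by positivity), sub_zero]
  have hVb : volume.real Box = (2 * η) ^ (L ^ 3) := by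
    rw [measureReal_def, hBoxdef, evt_volume_box_toReal (a := Real.pi - η) (b := Real.pi + η) (by linarith)]
    congr 1; ring
  -- (4) the box carries `∫ w ≥ m (2η)^{L³}`
  have hI_box : m * (2 * η) ^ (L ^ 3) ≤ I := by
    have h1 : volume.real Box • m ≤ ∫ θ in Box, w θ :=
      setIntegral_ge_of_const_le hBox_meas ((measure_mono hBox_cube).trans_lt hcube_fin).ne hBox_w
        (hwi.mono_set hBox_cube)
    have h2 : ∫ θ in Box, w θ ≤ I :=
      setIntegral_mono_set (hwi.mono_set Set.inter_subset_left) (ae_of_all _ fun θ => hw0 θ)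
        (LE.le.eventuallyLE hBox_G)
    rw [hVb, smul_eq_mul, mul_comm] at h1
    exact h1.trans h2
  have hIpos : 0 < I :=
    lt_of_lt_of_le (mul_pos (mul_pos (Real.exp_pos _) (Real.exp_pos _)) (pow_pos (by linarith) _)) hI_box
  -- (5) the bad region is dominated: `C (2π)^{L³} ≤ (1/12) m (2η)^{L³} ≤ I / 12`
  have hnum : C * (2 * Real.pi) ^ (L ^ 3) ≤ 1 / 12 * (m * (2 * η) ^ (L ^ 3)) := by
    have hA : 0 < A := Real.exp_pos _
    calc C * (2 * Real.pi) ^ (L ^ 3) = A * ((2 * Real.pi) ^ (L ^ 3) * Real.exp (-(J - 288 * ε) * h)) := by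
          rw [hCdef]; ring
      _ ≤ A * (1 / 12 * (Real.exp (-J) * (2 * η) ^ (L ^ 3))) := mul_le_mul_of_nonneg_left key hA.le
      _ = 1 / 12 * (m * (2 * η) ^ (L ^ 3)) := by rw [hmdef]; ring
  -- (6a) the real part of `Z_K`
  have hZsplit : Zk J K = (∫ θ in cube L ∩ G, f θ) + ∫ θ in cube L \ G, f θ := by
    show (∫ θ in cube L, f θ) = _
    exact (integral_inter_add_sdiff hG_meas hfi).symm
  have hgood_int_re : I / 6 ≤ (∫ θ in cube L ∩ G, f θ).re := by
    have h1 : (∫ θ in cube L ∩ G, f θ).re = ∫ θ in cube L ∩ G, (f θ).re := by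
      have h := integral_re (hfi.mono_set (s := cube L ∩ G) Set.inter_subset_left)
      simp only [RCLike.re_to_complex] at h
      exact h.symm
    have h2 : ∫ θ in cube L ∩ G, w θ / 6 ≤ ∫ θ in cube L ∩ G, (f θ).re :=
      setIntegral_mono_on ((hwi.mono_set Set.inter_subset_left).div_const 6)
        (hrei.mono_set Set.inter_subset_left) (hcube_meas.inter hG_meas) fun θ hθ => hgood_re θ hθ.2
    have h3 : ∫ θ in cube L ∩ G, w θ / 6 = I / 6 := integral_div 6 w
    rw [h1, ← h3]
    exact h2
  have hC0 : 0 ≤ C := (mul_pos (Real.exp_pos _) (Real.exp_pos _)).le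
  have hVbad : volume.real (cube L \ G) ≤ (2 * Real.pi) ^ (L ^ 3) :=
    hVc ▸ measureReal_mono Set.sdiff_subset hcube_fin.ne
  have hbad_fin : volume (cube L \ G) < ⊤ := (measure_mono Set.sdiff_subset).trans_lt hcube_fin
  have hbad_int : ‖∫ θ in cube L \ G, f θ‖ ≤ C * (2 * Real.pi) ^ (L ^ 3) := by
    calc ‖∫ θ in cube L \ G, f θ‖ ≤ C * volume.real (cube L \ G) :=
          norm_setIntegral_le_of_norm_le_const hbad_fin fun θ hθ => hbad θ (not_le.1 hθ.2)
      _ ≤ C * (2 * Real.pi) ^ (L ^ 3) := mul_le_mul_of_nonneg_left hVbad hC0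
  -- (6b) the integral of `‖f‖`
  have hnorm_split : ∫ θ in cube L, ‖f θ‖ = (∫ θ in cube L ∩ G, ‖f θ‖) + ∫ θ in cube L \ G, ‖f θ‖ :=
    (integral_inter_add_sdiff hG_meas hfi.norm).symm
  have hnorm_good : ∫ θ in cube L ∩ G, ‖f θ‖ ≤ 3 * I := by
    have h2 : ∫ θ in cube L ∩ G, ‖f θ‖ ≤ ∫ θ in cube L ∩ G, 3 * w θ :=
      setIntegral_mono_on (hfi.mono_set Set.inter_subset_left).norm
        ((hwi.mono_set Set.inter_subset_left).const_mul 3) (hcube_meas.inter hG_meas)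
        fun θ hθ => hgood_norm θ hθ.2
    rw [integral_const_mul] at h2
    exact h2
  have hnorm_bad : ∫ θ in cube L \ G, ‖f θ‖ ≤ C * (2 * Real.pi) ^ (L ^ 3) := by
    calc ∫ θ in cube L \ G, ‖f θ‖ ≤ ‖∫ θ in cube L \ G, ‖f θ‖‖ := Real.le_norm_self _
      _ ≤ C * volume.real (cube L \ G) :=
          norm_setIntegral_le_of_norm_le_const hbad_fin fun θ hθ => by
            rw [norm_norm]; exact hbad θ (not_le.1 hθ.2)
      _ ≤ C * (2 * Real.pi) ^ (L ^ 3) := mul_le_mul_of_nonneg_left hVbad hC0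
  -- conclusion
  refine ⟨I, hIpos, ?_, ?_⟩
  · have hre_bad : -(C * (2 * Real.pi) ^ (L ^ 3)) ≤ (∫ θ in cube L \ G, f θ).re := by
      have := (abs_le.1 ((Complex.abs_re_le_norm (∫ θ in cube L \ G, f θ)).trans hbad_int)).1
      linarith
    rw [hZsplit, Complex.add_re]
    linarith [hgood_int_re, hre_bad, hnum, hI_box]
  · change ∫ θ in cube L, ‖f θ‖ ≤ 37 / 12 * I
    rw [hnorm_split]
    linarith [hnorm_good, hnorm_bad, hnum, hI_box]

/-- **Explicit coupling threshold for complex stability at fixed volume.** For `0 < ε ≤ 1/576`, every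
torus `(ℤ/Lℤ)³`, every `J ≥ 1152 ε L³ (4 + log L)` and every kernel `K` admissible at radius `ε`, the
perturbed partition function does not vanish and the complex plateau is bounded by `40`.  Good/bad region
split along `H = Σ_b (1 - cos ∇_b θ) ≤ 1/(288ε)`: on the good region the uniform relative form bound
`‖W_K‖ ≤ 288 ε H ≤ 1` gives `Re (w_J e^{W_K}) ≥ w_J/6` and `‖w_J e^{W_K}‖ ≤ 3 w_J`; the bad region has
weight `≤ (2π)^{L³} e^{3L³J} e^{-(J-288ε)/(288ε)}`, which the threshold makes `≤ 1/12` of the good mass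
`≥ e^{3L³J} e^{-J} (2/(3L²))^{L³}` carried by the box `|θ - π| ≤ 1/(3L²)`; hence `‖Z_K‖ ≥ I/12` and
`‖num_K‖ ≤ L⁶ (37/12) I`. -/
theorem stub_explicitVolumeThreshold : ∀ (L : ℕ) [NeZero L] (ε : ℝ), 0 < ε → 576 * ε ≤ 1 →
    ∀ (J : ℝ), 1152 * ε * (L : ℝ) ^ 3 * (4 + Real.log (L : ℝ)) ≤ J →
      ∀ K : Bond L → Bond L → ℂ, Admissible L ε K → Zk J K ≠ 0 ∧ ‖cratio L J K‖ ≤ 40 := by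
  intro L _ ε hε hε1 J hJ K hK
  obtain ⟨I, hIpos, hre, hnorm⟩ := evt_core hε hε1 hJ hK
  have hnum := sv_norm_num_le (L := L) J K
  have hZ : I / 12 ≤ ‖Zk J K‖ := hre.trans (Complex.re_le_norm _)
  have hZpos : 0 < ‖Zk J K‖ := lt_of_lt_of_le (by positivity) hZ
  refine ⟨norm_pos_iff.1 hZpos, ?_⟩
  have hL : (0:ℝ) < (L : ℝ) ^ 6 := by
    have := NeZero.pos L; positivity
  unfold cratio
  rw [norm_div, norm_div]
  have hL' : ‖((L : ℂ)) ^ 6‖ = (L : ℝ) ^ 6 := by simp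
  rw [hL', div_div, div_le_iff₀ (by positivity)]
  calc ‖num J K‖ ≤ (L : ℝ) ^ 6 * ∫ θ in cube L, ‖wJ J θ * Complex.exp (Wk K θ)‖ := hnum
    _ ≤ (L : ℝ) ^ 6 * (37 / 12 * I) := by gcongr
    _ ≤ (L : ℝ) ^ 6 * (40 * (I / 12)) := mul_le_mul_of_nonneg_left (by linarith) hL.le
    _ ≤ (L : ℝ) ^ 6 * (40 * ‖Zk J K‖) := by gcongr
    _ = 40 * (‖Zk J K‖ * (L : ℝ) ^ 6) := by ring

end Summit.HubbardSuperconductivity.HubbardSuperconductivity.Theorems.PerturbedXYOrder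

end
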